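import Literature.AlgebraicGeometry.Frobenioids.PerfectionModelType
import Literature.AlgebraicGeometry.Frobenioids.PerfectionIsFrobenioid
import Literature.AlgebraicGeometry.Frobenioids.CoAngular
import Literature.AlgebraicGeometry.Frobenioids.BirationalizationFrobenioidGeneral
import HarnessLib

/-!
# Frobenioids I, Proposition 5.5 (iii), model clause — UNCONDITIONAL form for Frobenioids of isotropic type:
# the perfection of a Frobenioid of isotropic and model type is of model type (abc-iut cell, layer L1,
# node `FrdI:Prop5.5(iii)`, sub-DAG row `FrdI:Prop5.5(iii)/P55-L06`)

Mochizuki, *The geometry of Frobenioids I: the general theory*, Kyushu J. Math. **62** (2008)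
293–400, §5, Proposition 5.5 (iii), kurims text p. 104 ll. 36–37 ("If `C` is of … model type, then so is
`C^pf`"), proof p. 105 ll. 11–20; Def. 4.5 (i) p. 86 ("model type" = pre-model and birationally
Frobenius-normalized type; Def. 2.7 presupposes `C` of isotropic type). [cite: MochizukiFrdI2008, Prop. 5.5 (iii) p.104]

PROOF-ONLY assembly (no definitions).  The slot closers of `PerfectionModelType.lean` are stated inside the
schema `FrdI.Prop55Sub.Prop55iii_pf_model` (a `∀ hPf : IsFrobenioid (C^pf → F_{Φ^pf}), …` statement in seat
abc-iut-L1-t3's operations vocabulary).  Here the same content is recorded in the vocabulary that [FrdI]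
Thm. 5.2 (iv) consumes (seat abc-iut-L6-t8's `PreFrobenioid.IsOfModelType F hF hsq`, Def. 4.5 (i)), with every
binder DISCHARGED by landed theorems:
* "`C^pf` is a Frobenioid" (Prop. 3.2 (iii)) = seats abc-iut-L1-d9/L1-d1's `Perfection.isFrobenioid hF hiso`
  (`PerfectionIsFrobenioid.lean`; a Frobenioid of isotropic type is of Frobenius-isotropic type — identities are
  of Frobenius type);
* "`C^birat` is a Frobenioid" (Prop. 4.4 (ii), author's 2024 form) = seat abc-iut-w5-d227's
  `isFrobenioid_biratData_ops_toFunctor` (isotropic + birationally Frobenius-normalized);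
* pre-model conjunct = `Perfection.isOfPreModelType_of` (this seat, `PerfectionModelType.lean`); birational
  conjunct = seat abc-iut-w5-d042's `PerfectionBirat.isOfBiratFrobeniusNormalizedType_biratData_perfection`
  (`PerfectionBiratNormalized.lean`), the two renderings of Def. 4.5 (i) agreeing by
  `isBiratFrobeniusNormalized_iff_biratData`.
Result: `PreFrobenioid.Perfection.isOfModelType_perfection` — for a Frobenioid `C` of isotropic and model type,
`C^pf → F_{Φ^pf}` is of model type; CONDITIONAL on nothing beyond print's standing hypotheses.  No statement of
the paper is strengthened; nothing here bears on [IUTchIII] Cor. 3.12.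
-/

namespace Literature.AlgebraicGeometry.Frobenioids

open CategoryTheory Opposite

universe w v v' u u'

namespace PreFrobenioid

variable {D : Type u} [Category.{v} D] {Φ : Dᵒᵖ ⥤ CommMonCat.{w}}
  {C : Type u'} [Category.{v'} C] {F : C ⥤ ElemFrobenioid Φ}

namespace Perfection

/-- A Frobenioid of isotropic type is of Frobenius-isotropic type (the identity of `A` is an arrow of Frobenius
type to an isotropic object). [cite: MochizukiFrdI2008, Def. 1.2 (iv) p.23] -/
theorem isOfType_isFrobeniusIsotropic_of_isOfIsotropicType (hF : IsFrobenioid F) (hiso : IsOfIsotropicType F) :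
    IsOfType (IsFrobeniusIsotropic F) :=
  fun A => ⟨A, 𝟙 A, PreFrobenioid.isFrobeniusType_of_isIso F hF.isPreFrobenioid (𝟙 A), hiso A⟩

/-- **Prop. 5.5 (iii), model clause, UNCONDITIONAL for isotropic `C`**: if the Frobenioid `C → F_Φ` is of
isotropic type and of model type (Def. 4.5 (i): pre-model and birationally Frobenius-normalized, here in the
vocabulary `IsOfModelType F hF hsq` that Thm. 5.2 (iv) consumes), then its perfection `C^pf → F_{Φ^pf}` — a
Frobenioid by Prop. 3.2 (iii) (`Perfection.isFrobenioid`) — is of model type (at THE birationalization of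
`C^pf`, any `hsq'`). [cite: MochizukiFrdI2008, Prop. 5.5 (iii) p.104] -/
theorem isOfModelType_perfection (hF : IsFrobenioid F) (hiso : IsOfIsotropicType F) {hsq : HasBiratSquares F}
    (hm : IsOfModelType F hF hsq)
    (hsq' : HasBiratSquares (ops hF).toFunctor) :
    IsOfModelType (ops hF).toFunctor
      (Perfection.isFrobenioid hF (isOfType_isFrobeniusIsotropic_of_isOfIsotropicType hF hiso)) hsq' := by
  have hbn : PreFrobenioidData.IsOfBiratFrobeniusNormalizedType (biratData hF hsq) :=
    ⟨fun A => (isBiratFrobeniusNormalized_iff_biratData A).mp (hm.2 A)⟩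
  have hBi : IsFrobenioid (biratOps hF hsq).toFunctor := isFrobenioid_biratData_ops_toFunctor hF hsq hiso hm.2
  refine ⟨isOfPreModelType_of hF hm.1, fun X => (isBiratFrobeniusNormalized_iff_biratData X).mpr ?_⟩
  exact (PerfectionBirat.isOfBiratFrobeniusNormalizedType_biratData_perfection _ hsq' hBi hbn).obj X

/-- The same at THE birational squares of `C^pf` supplied by Prop. 1.11 (vii) (`hasBiratSquares_of_isFrobenioid`),
the literal shape of Thm. 5.2 (iv)'s hypothesis for the Frobenioid `C^pf`. [cite: MochizukiFrdI2008, Prop. 5.5 (iii) p.104] -/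
theorem isOfModelType_perfection' (hF : IsFrobenioid F) (hiso : IsOfIsotropicType F) {hsq : HasBiratSquares F}
    (hm : IsOfModelType F hF hsq) :
    IsOfModelType (ops hF).toFunctor
      (Perfection.isFrobenioid hF (isOfType_isFrobeniusIsotropic_of_isOfIsotropicType hF hiso))
      (hasBiratSquares_of_isFrobenioid
        (Perfection.isFrobenioid hF (isOfType_isFrobeniusIsotropic_of_isOfIsotropicType hF hiso))) :=
  isOfModelType_perfection hF hiso hm _

/-- **The slot `FrdI.Prop55Sub.Prop55iii_pf_model` for isotropic `C`, with its `hPf` binder inhabited**: the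
closer `prop55iii_pf_model_of_isOfIsotropicType` applied at Prop. 3.2 (iii) (`Perfection.isFrobenioid`) — the
model-type conclusion for `C^pf` from the slot's own hypotheses, no binder left open.
[cite: MochizukiFrdI2008, Prop. 5.5 (iii) p.104] -/
theorem isOfPreModelType_and_isOfBiratFrobeniusNormalizedType_perfection (hF : IsFrobenioid F)
    (hiso : IsOfIsotropicType F) (hnorm : IsOfType (IsFrobeniusNormalized F))
    (h : IsOfPreModelType F ∧
      PreFrobenioidData.IsOfBiratFrobeniusNormalizedType (biratData hF (hasBiratSquares_of_isFrobenioid hF))) :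
    IsOfPreModelType (ops hF).toFunctor ∧
      PreFrobenioidData.IsOfBiratFrobeniusNormalizedType
        (biratData (Perfection.isFrobenioid hF (isOfType_isFrobeniusIsotropic_of_isOfIsotropicType hF hiso))
          (hasBiratSquares_of_isFrobenioid
            (Perfection.isFrobenioid hF (isOfType_isFrobeniusIsotropic_of_isOfIsotropicType hF hiso)))) :=
  FrdI.Prop55Sub.prop55iii_pf_model_of_isOfIsotropicType hF hiso
    (isOfType_isFrobeniusIsotropic_of_isOfIsotropicType hF hiso) hnorm _ h

/-- **Prop. 5.5 (iii), model clause, for EVERY Frobenioid — no isotropy**: if the Frobenioid `C → F_Φ` is of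
model type (`IsOfModelType F hF hsq`: pre-model and birationally Frobenius-normalized, Def. 4.5 (i)) and its
perfection `C^pf → F_{Φ^pf}` is a Frobenioid (`hPf`, Prop. 3.2 (iii)), then `C^pf` is of model type (at any
`hsq'`).  The input "`C^birat` is a Frobenioid" (Prop. 4.4 (ii)) of `isOfModelType_perfection` is now seat
abc-iut-L6-t20's general `isFrobenioid_biratOps_toFunctor_general`, fed by the birational Frobenius-normalization
half of `hm` itself; the pre-model half is this seat's `isOfPreModelType_of`, the normalization half seat
abc-iut-w5-d042's `PerfectionBirat.isOfBiratFrobeniusNormalizedType_biratData_perfection`.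
[cite: MochizukiFrdI2008, Prop. 5.5 (iii) p.104] -/
theorem isOfModelType_perfection_general (hF : IsFrobenioid F) {hsq : HasBiratSquares F}
    (hm : IsOfModelType F hF hsq) (hPf : IsFrobenioid (ops hF).toFunctor)
    (hsq' : HasBiratSquares (ops hF).toFunctor) :
    IsOfModelType (ops hF).toFunctor hPf hsq' := by
  have hbn : PreFrobenioidData.IsOfBiratFrobeniusNormalizedType (biratData hF hsq) :=
    ⟨fun A => (isBiratFrobeniusNormalized_iff_biratData A).mp (hm.2 A)⟩
  have hBi : IsFrobenioid (biratOps hF hsq).toFunctor := isFrobenioid_biratOps_toFunctor_general hF hsq hm.2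
  refine ⟨isOfPreModelType_of hF hm.1, fun X => (isBiratFrobeniusNormalized_iff_biratData X).mpr ?_⟩
  exact (PerfectionBirat.isOfBiratFrobeniusNormalizedType_biratData_perfection _ hsq' hBi hbn).obj X

/-- The same with Prop. 3.2 (iii) inhabited by seat abc-iut-L1-d9's `Perfection.isFrobenioid` for `C` of
Frobenius-isotropic type (§3's standing hypothesis) — `isOfModelType_perfection` with "isotropic" weakened to
"Frobenius-isotropic" and nothing else assumed. [cite: MochizukiFrdI2008, Prop. 5.5 (iii) p.104] -/
theorem isOfModelType_perfection_of_isFrobeniusIsotropic (hF : IsFrobenioid F)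
    (hfi : IsOfType (IsFrobeniusIsotropic F)) {hsq : HasBiratSquares F} (hm : IsOfModelType F hF hsq)
    (hsq' : HasBiratSquares (ops hF).toFunctor) :
    IsOfModelType (ops hF).toFunctor (Perfection.isFrobenioid hF hfi) hsq' :=
  isOfModelType_perfection_general hF hm _ hsq'

/-- The same at THE birational squares of `C^pf` (Prop. 1.11 (vii), `hasBiratSquares_of_isFrobenioid`) — the
literal shape of Thm. 5.2 (iv)'s hypothesis for the Frobenioid `C^pf`, for `C` of Frobenius-isotropic and model
type. [cite: MochizukiFrdI2008, Prop. 5.5 (iii) p.104] -/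
theorem isOfModelType_perfection_of_isFrobeniusIsotropic' (hF : IsFrobenioid F)
    (hfi : IsOfType (IsFrobeniusIsotropic F)) {hsq : HasBiratSquares F} (hm : IsOfModelType F hF hsq) :
    IsOfModelType (ops hF).toFunctor (Perfection.isFrobenioid hF hfi)
      (hasBiratSquares_of_isFrobenioid (Perfection.isFrobenioid hF hfi)) :=
  isOfModelType_perfection_general hF hm _ _

end Perfection

end PreFrobenioid

end Literature.AlgebraicGeometry.Frobenioids
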